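import Mathlib
import Literature.MathematicalPhysics.StatisticalMechanics.BarlowStacking
import Summits.Ventures.Crystal3D.StickySpheres.ContactGraph
import Summits.Ventures.Crystal3D.Theorems.StickyWulffConstantLayerChainDefs
import HarnessLib

/-!
# Line `LayerChain` v4 — DEFINITIONS file (port-ready, sorry-free) for the crux `StackingLiminf` (stmt-Ventures-19145)
# (imports made ROUTE-INDEPENDENT 2026-08-27: no `Theses` import, so stub files importing this module stay
# outside the theses cone — lint.theses-cone; declarations unchanged)
# Land verbatim as `Theorems/StickyWulffConstantStackingLiminfLayerChainV4Defs.lean` (--supports stmt-Ventures-19145, helper):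
# the REGISTERED stubs of the skeleton `HOME/cf-p1/route/lines/LayerChainV4.lean` are stated over exactly these names.
# "MOLLIFY, MODULATE, BRUNN–MINKOWSKI": the XL stub `chimera` of v3 re-cut into four stubs,
# none of which needs BV compactness, blow-up, reduced boundaries or a Knothe map.

Route `StickyWulffConstant` (cell `crystal3d-full`, planner cf-p1 gen 13, 2026-08-27).

## Where v3 stood
v3 (`Lines/LayerChain.lean`, evidence on stmt-Ventures-19145) had four stubs; three are PROVED in the
tree — `stub_layerDecomposition` (p456192), `stub_calibration` (p473564: strong duality
`stackTension f n = max admissible calibFlux`), `stub_sliceDomination` (p476944) — and the banked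
`StackVolumeLaw` (p480093).  Since then the tree ALSO gained the continuum half of the old chimera step:
`Theorems.Chimera.chimera_stackWulff` (height-modulated Brunn–Minkowski:
`|A|^{1/3} + r |W_0|^{1/3} ≤ |{a + r w : a ∈ A, w ∈ W_{f(a₃)}}|^{1/3}` for EVERY profile `f`,
`|W_0| = 64√2`).  The one open stub was `stub_chimera : Calibration → SliceDomination → SymChainBound`
(XL: Γ-liminf by blow-up + transport).

## The v4 cut (this file)
Let `X = {x_i} ⊂ Λ_σ` (`N` points of the Barlow stacking of the Hägg word `σ`, bond length 1,
`h = √(2/3)`), `D = 6N − #contacts` (so `2D` = number of (site, missing-neighbour) pairs).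
* MOLLIFY at scale `K` (explicit C² bump `φ_K`, `∫φ_K = 1/√2` = 1/number density):
  `v = Σ_i φ_K(· − x_i)`; then LATERALLY at scale `L ≥ K` (explicit 2D bump `η_L`): `w = v *_∥ η_L`
  (`smooth x K L` below).  `f̄ = window σ K` is the `K`-window density of `−1` gaps at each height.
* (B) `MollifiedUpper` — the DISCRETE → CONTINUUM inequality with the EXACT constant:
  `∫ stackTension (f̄ y₃) (−∇w(y)) dy ≤ √2·D + C₀ (N/K² + K·D/L)`.
  Mechanism: per bond class the triangle inequality is sharp (`‖v_k(·−b) − v_{k+1}‖₁ ≤ #broken/√2`,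
  bonded pairs cancel exactly); Taylor (`C N/K²`); then the TWO-PHASE PAIRING: for admissible fields
  `(α, β⁺, β⁻)` (box + Kirchhoff `Σβ⁺ = Σβ⁻`, i.e. a point of `W_f` by `mem_stackWulff_of_certificate`)
  `Σ_k Σ_i β^{σ_k}_i (−∂_{b_{k,i}} v_k + v_k − v_{k+1}) = Σ_i β⁺_i(−∂_{b⁺_i} V⁺) + Σ_i β⁻_i(−∂_{b⁻_i} V⁻)`
  EXACTLY (Kirchhoff telescopes the layer differences; `V^± = Σ_{σ_k = ±1} v_k`), and with
  `V⁻ = f̄ v + E`: `= ⟨−∇v, A + (1−f̄)B⁺ + f̄ B⁻⟩ + ⟨∇_∥E, Σ_i(β⁺_i+β⁻_i)ℓ_i⟩` (the `f̄'` term dies by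
  Kirchhoff again: height variation of the word is free).  `strong duality = stub_calibration` turns the
  first term, after the lateral average `η_L`, into `stackTension (f̄) (−∇w)`; the second is
  `≤ 2√3 ‖E‖₁ ‖∇η_L‖₁ ≤ C K D / L` because `|E| ≤ min(v, 1−v)` lives in the `K`-boundary layer
  (discrete local isoperimetry at scale `K`: dust `θ^{1/3} K D`, voids idem, mixed windows `θ^{-2/3} K D`).
* (A) `ModulatedWulff` — the CONTINUUM theorem, for every C² compactly supported `w ≥ 0` and continuous
  `g : ℝ → [0,1]`: `3 |W_0|^{1/3} ∫_0^∞ |{w > t}|^{2/3} dt ≤ ∫ stackTension (g y₃) (−∇w(y)) dy`.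
  Mechanism: sup-convolution `w_r(y) = sup {w(a) : y − a ∈ r W_{g(a₃)}}` has `{w_r > t} ⊇ {w > t} ⊕_g rW`,
  so `chimera_stackWulff` (IN THE TREE) + binomial expansion give `|{w_r>t}| − |{w>t}| ≥ 3r|W_0|^{1/3}|{w>t}|^{2/3}`
  for EVERY `r > 0`; layer-cake gives `∫(w_r − w) = ∫_0^∞ (|{w_r>t}| − |{w>t}|) dt`; Taylor around `a`
  gives `w_r − w ≤ r · sup_{B(y, cr)} stackTension(g)(−∇w) + C r²`; divide by `r`, let `r → 0`
  (dominated convergence, continuity of the integrand).  No transport, no coarea, no BV.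
* (C) `PlateauBound` — for the explicit `w`: if `D ≤ 12 N^{2/3}`, `K₀ ≤ K ≤ L ≤ λ₀ N^{1/3}` then
  `∫_0^∞ |{w>t}|^{2/3} dt ≥ (1−ε)(N/√2)^{2/3}` (stated in route units, see the def).  Mechanism: `∫w = N/√2`,
  `w ≤ 1 + o_K(1)` (lattice sums of the bump), and the mass where `w ≤ 1 − θ` is `≤ C θ^{-2/3} L D`
  (windows of intermediate density each carry `≥ c θ^{2/3} L²` broken bonds — Bollobás–Leader edge
  isoperimetry in a grid box, applied in a sheared `ℤ³` frame of `Λ_σ` — plus dust/void mass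
  `≤ C θ^{1/3} L D` from the all-`N` cluster bound `cbrt243_rpow_le_contactDeficiency_of_subset_barlow`).
* (D) `MollifierRegularity` — the explicit `w` is C², compactly supported, `≥ 0`; `f̄` is continuous with
  values in `[0,1]` (for `K ≥ 1 > h/2` the denominator never vanishes).
* `StackingLiminf_of` — the kernel-checked composition (parameter choice `K = δ² N^{1/3}`,
  `L = λ₀ N^{1/3}`, dichotomy `D ≶ 12 N^{2/3}`, `κ = 6·2^{1/3} ≤ 12`), concluding the route decl
  `Summit.Ventures.Crystal3D.Theses.StickyWulffConstant.StackingLiminf` BY NAME.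

Sizes: (A) M/L (analysis around an in-tree theorem), (B) L (the new algebra + two elementary estimates),
(C) M/L (discrete local isoperimetry), (D) S/M.  Hardest: (B).  Uses by name: `stub_calibration`,
`calibFlux_le_stackPhi`, `mem_stackWulff_of_certificate`, `chimera_stackWulff`, `volume_stackWulff_zero`.
WHAT THIS IS NOT: nothing here is proved except the composition; rung F-C1 not moved.
-/

noncomputable section

namespace Summit.Ventures.Crystal3D.Cruxes.StackingLiminf.LayerChainV4

open MeasureTheory Set Filter
open Literature.MathematicalPhysics.StatisticalMechanics (IsHaggSeq barlowStacking)
open Summit.Ventures.Crystal3D.LayerChain (dot3 stackTension stackWulff)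

/-! ### The explicit mollifiers (all constants fixed) -/

/-- Normalisation of the 3D bump: `∫_{ℝ³} (1 − |u|²)_+³ du = 64π/315`, and we want `∫ φ_1 = 1/√2`
(the inverse number density of a Barlow stacking at bond length 1). -/
def bumpConst : ℝ := 315 / (64 * Real.pi * Real.sqrt 2)

/-- The C² bump `φ_K(u) = bumpConst · K⁻³ · (1 − |u|²/K²)_+³` (radius `K`, `∫ φ_K = 1/√2`). -/
def bump (K : ℝ) (u : Fin 3 → ℝ) : ℝ :=
  bumpConst / K ^ 3 * (max 0 (1 - dot3 u u / K ^ 2)) ^ 3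

/-- The lateral C² kernel `η_L(z) = (4/π) L⁻² (1 − |z|²/L²)_+³` on `ℝ²` (`∫ η_L = 1`). -/
def eta (L : ℝ) (z : ℝ × ℝ) : ℝ :=
  4 / (Real.pi * L ^ 2) * (max 0 (1 - (z.1 ^ 2 + z.2 ^ 2) / L ^ 2)) ^ 3

/-- The `K`-mollified empirical density `v(y) = Σ_i φ_K(y − x_i)` of a configuration. -/
def dens {N : ℕ} (x : Fin N → EuclideanSpace ℝ (Fin 3)) (K : ℝ) (y : Fin 3 → ℝ) : ℝ :=
  ∑ i : Fin N, bump K (fun j => y j - x i j)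

/-- The doubly mollified density `w = v *_∥ η_L` (lateral average at scale `L` of `dens x K`). -/
def smooth {N : ℕ} (x : Fin N → EuclideanSpace ℝ (Fin 3)) (K L : ℝ) (y : Fin 3 → ℝ) : ℝ :=
  ∫ z : ℝ × ℝ, eta L z * dens x K (fun j => y j - (![z.1, z.2, 0] : Fin 3 → ℝ) j)

/-- Height profile of one FULL mollified layer (up to the areal density factor, which cancels in
`window`): `c_K(ζ) = ∫_{ℝ²} φ_K(z, ζ) dz`. -/
def layerProf (K ζ : ℝ) : ℝ :=
  ∫ z : ℝ × ℝ, bump K (![z.1, z.2, ζ] : Fin 3 → ℝ)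

/-- The `K`-window density of `−1` gaps at height `t`: gap `k` (between layers `k`, `k+1`, heights
`k h`, `(k+1) h`, `h = √(2/3)`) has letter `σ k` and is weighted by the profile of the layer BELOW it.
Values in `[0,1]`; `x / 0 = 0` makes it total. -/
def window (σ : ℤ → ℤ) (K t : ℝ) : ℝ :=
  (∑ᶠ k : ℤ, if σ k = -1 then layerProf K (t - k * Real.sqrt (2 / 3)) else 0) /
    (∑ᶠ k : ℤ, layerProf K (t - k * Real.sqrt (2 / 3)))

/-- Minus the gradient of `w` at `y`, as a plain vector (`stackTension` is even and 1-homogeneous in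
its second argument, so only the direction/size matter). -/
def negGrad (w : (Fin 3 → ℝ) → ℝ) (y : Fin 3 → ℝ) : Fin 3 → ℝ :=
  fun j => -(fderiv ℝ w y (Pi.single j 1))

/-- The HEIGHT-MODULATED anisotropic total variation `∫ stackTension (g y₃) (−∇w(y)) dy`
(`stackTension f = ` support function of the stacking Wulff body `W_f`, `LayerChainDefs`). -/
def modTV (w : (Fin 3 → ℝ) → ℝ) (g : ℝ → ℝ) : ℝ :=
  ∫ y : Fin 3 → ℝ, stackTension (g (y 2)) (negGrad w y)

/-- The plateau functional `∫_0^∞ |{w > t}|^{2/3} dt` (the layer-cake side of Brunn–Minkowski). -/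
def plateau (w : (Fin 3 → ℝ) → ℝ) : ℝ :=
  ∫ t in Ioi (0 : ℝ), ((volume {y : Fin 3 → ℝ | t < w y}).toReal) ^ ((2 : ℝ) / 3)

/-! ### The four stubs -/

/-- (A) **Modulated Wulff inequality** (continuum; from the in-tree `chimera_stackWulff` by
sup-convolution + layer-cake + `r → 0`).  `3 |W_0|^{1/3} = 3 (64√2)^{1/3}`. -/
def ModulatedWulff : Prop :=
  ∀ (w : (Fin 3 → ℝ) → ℝ) (g : ℝ → ℝ), ContDiff ℝ 2 w → HasCompactSupport w → (∀ y, 0 ≤ w y) →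
    Continuous g → (∀ t, 0 ≤ g t ∧ g t ≤ 1) →
      3 * (64 * Real.sqrt 2) ^ ((1 : ℝ) / 3) * plateau w ≤ modTV w g

/-- (B) **Mollification inequality** (discrete → continuum, exact constant `√2`): the modulated total
variation of the doubly mollified density is at most `√2 · D` up to `C₀ (N/K² + K D/L)`. -/
def MollifiedUpper : Prop :=
  ∃ C₀ : ℝ, 0 < C₀ ∧ ∀ (N : ℕ) (σ : ℤ → ℤ), IsHaggSeq σ →
    ∀ x : Fin N → EuclideanSpace ℝ (Fin 3), Function.Injective x →
      (∀ i, x i ∈ barlowStacking 1 (Real.sqrt (2 / 3)) σ) →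
      ∀ K L : ℝ, 1 ≤ K → K ≤ L →
        modTV (smooth x K L) (window σ K) ≤
          Real.sqrt 2 * (6 * (N : ℝ) - (Summit.Ventures.Crystal3D.numContacts x : ℝ)) +
            C₀ * ((N : ℝ) / K ^ 2 +
              K * (6 * (N : ℝ) - (Summit.Ventures.Crystal3D.numContacts x : ℝ)) / L)

/-- (C) **Plateau bound** (discrete local isoperimetry at scale `L`): for near-optimal configurations
(`D ≤ 12 N^{2/3}`) and `K₀ ≤ K ≤ L ≤ λ₀ N^{1/3}` the plateau functional of the mollified density is
`≥ (1 − ε)(N/√2)^{2/3}`; stated in route units via `3 (64√2)^{1/3} (N/√2)^{2/3} = √2 · 6·2^{1/3} · N^{2/3}`. -/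
def PlateauBound : Prop :=
  ∀ ε : ℝ, 0 < ε → ∃ lam : ℝ, 0 < lam ∧ ∃ K₀ : ℝ, ∃ N₀ : ℕ, ∀ N : ℕ, N₀ ≤ N →
    ∀ σ : ℤ → ℤ, IsHaggSeq σ → ∀ x : Fin N → EuclideanSpace ℝ (Fin 3), Function.Injective x →
      (∀ i, x i ∈ barlowStacking 1 (Real.sqrt (2 / 3)) σ) →
      ∀ K L : ℝ, K₀ ≤ K → K ≤ L → L ≤ lam * (N : ℝ) ^ ((1 : ℝ) / 3) →
        6 * (N : ℝ) - (Summit.Ventures.Crystal3D.numContacts x : ℝ) ≤ 12 * (N : ℝ) ^ ((2 : ℝ) / 3) →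
          (1 - ε) * (Real.sqrt 2 * (6 * (2 : ℝ) ^ ((1 : ℝ) / 3))) * (N : ℝ) ^ ((2 : ℝ) / 3) ≤
            3 * (64 * Real.sqrt 2) ^ ((1 : ℝ) / 3) * plateau (smooth x K L)

/-- (D) **Regularity of the explicit mollifiers** (routine): `w` is C², compactly supported and
nonnegative; the window density is continuous with values in `[0,1]`. -/
def MollifierRegularity : Prop :=
  ∀ (N : ℕ) (σ : ℤ → ℤ), IsHaggSeq σ → ∀ x : Fin N → EuclideanSpace ℝ (Fin 3),
    ∀ K L : ℝ, 1 ≤ K → K ≤ L →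
      ContDiff ℝ 2 (smooth x K L) ∧ HasCompactSupport (smooth x K L) ∧ (∀ y, 0 ≤ smooth x K L y) ∧
        Continuous (window σ K) ∧ (∀ t, 0 ≤ window σ K t ∧ window σ K t ≤ 1)

/-! ### Arithmetic helpers for the composition

(`one_le_sqrt_two` and `cbrt_cube` of the planner's file are omitted: the gate's dedup found them
already landed as `Literature.Analysis.FluidPDE.Tao2016.one_le_sqrt_two` and
`Literature.NumberTheory.Sieve.rpow_third_pow_three`; the skeleton restates them inline.) -/

/-- `κ = 6·2^{1/3} ≤ 12` (used in the far-from-optimal branch of the composition). -/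
theorem kappa_le_twelve : 6 * (2 : ℝ) ^ ((1 : ℝ) / 3) ≤ 12 := by
  have h : (2 : ℝ) ^ ((1 : ℝ) / 3) ≤ (2 : ℝ) ^ (1 : ℝ) :=
    Real.rpow_le_rpow_of_exponent_le (by norm_num) (by norm_num)
  rw [Real.rpow_one] at h
  linarith

/-- `0 ≤ κ = 6·2^{1/3}`. -/
theorem kappa_nonneg : 0 ≤ 6 * (2 : ℝ) ^ ((1 : ℝ) / 3) := by positivity

/-- `(n^{1/3})² = n^{2/3}` for `n ≥ 0`. -/
theorem cbrt_sq {n : ℝ} (hn : 0 ≤ n) : (n ^ ((1 : ℝ) / 3)) ^ 2 = n ^ ((2 : ℝ) / 3) := by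
  rw [← Real.rpow_natCast, ← Real.rpow_mul hn]; norm_num

/-- Eventually `T ≤ N^{1/3}` along the naturals. -/
theorem exists_nat_cbrt_ge (T : ℝ) : ∃ N₁ : ℕ, ∀ N : ℕ, N₁ ≤ N → T ≤ (N : ℝ) ^ ((1 : ℝ) / 3) := by
  have h : Tendsto (fun N : ℕ => ((N : ℝ)) ^ ((1 : ℝ) / 3)) atTop atTop :=
    (tendsto_rpow_atTop (by norm_num : (0 : ℝ) < 1 / 3)).comp tendsto_natCast_atTop_atTop
  have h' := (h.eventually (eventually_ge_atTop T))
  obtain ⟨N₁, hN₁⟩ := eventually_atTop.1 h'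
  exact ⟨N₁, hN₁⟩

end Summit.Ventures.Crystal3D.Cruxes.StackingLiminf.LayerChainV4
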